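import Literature.NumberTheory.Automorphic.AdelicPiSchwartzBruhatFourier
import Literature.NumberTheory.Automorphic.MatrixAdeleModule
import HarnessLib

/-!
# Poisson summation and the Fourier transform on `𝒮(M_n(𝔸_K))`; twists `Φ(A x B)`

Topic `NumberTheory/Automorphic`; namespace `Literature.NumberTheory.Automorphic`. The transport of
the Schwartz–Bruhat theory of `𝔸_K^ι` (`AdelicPiSchwartzBruhatFourier`: Poisson summation, stability
under the Fourier transform) to the matrix space `M_n(𝔸_K) ≅ 𝔸_K^{n × n}` and the Schwartz–Bruhat
space `𝒮(M_n(𝔸_K)) = schwartzBruhatAdelicMatrix n K` of `GodementJacquetZetaIntegrals`, together with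
the behaviour under the two-sided twists `Φ ↦ Φ(A · B)` — the inputs of the theta-series identity in
the analytic continuation of the global zeta integrals of Godement–Jacquet (LNM 260, §11, proof of
Thm. 11.2; §12–13: Poisson summation applied to `ξ ↦ Φ(h⁻¹ ξ g)` on `M_n(K)`, with Fourier transform
`|det g h⁻¹|ⁿ Φ̂(g⁻¹ · h)`). Everything is proved:

* Twists: `IsFactorizableSchwartzBruhat.comp_mul_mul`, `comp_mul_mul_mem_schwartzBruhatAdelicMatrix`
  (**`𝒮(M_n(𝔸_K))` is stable under `Φ ↦ Φ(A · B)`**, `A, B ∈ GL_n(𝔸_K)`: the archimedean factor is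
  composed with the linear automorphism `archTwistCLE`, the finite one with `finTwistHomeomorph`);
  `adelicMatrixFourier n K λ Φ η = ∫ Φ(x) ψ(tr(η x)) dλ(x)` (trace pairing, `ψ = adeleAddChar K`);
  `map_twistHomeomorph_eq_smul` (**`(x ↦ A x B)_* λ = |det A|_𝔸⁻ⁿ|det B|_𝔸⁻ⁿ λ`**, from the modules of
  `MatrixAdeleModule`, Weil BNT IV §3) and the **substitution formula**
  `adelicMatrixFourier_comp_mul_mul`: `(Φ(A · B))^(η) = |det A|_𝔸⁻ⁿ |det B|_𝔸⁻ⁿ Φ̂(B⁻¹ η A⁻¹)`.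
* Transport: `IsFactorizablePiSchwartzBruhat.comp_equiv` / `comp_equiv_mem_piSchwartzBruhat`
  (reindexing the coordinates of `𝔸_K^ι`), `piOfMatrix` / `matrixOfPi` / `matrixPiAddEquiv`
  (`M_n(𝔸_K) ≃ₜ+ 𝔸_K^{n × n}`), `archCurryCLE`, `finCurryHomeomorph`, and the two directions
  `mem_piSchwartzBruhat_of_mem_schwartzBruhatAdelicMatrix`,
  `mem_schwartzBruhatAdelicMatrix_of_mem_piSchwartzBruhat` (**`𝒮(M_n(𝔸_K)) ≅ 𝒮(𝔸_K^{n × n})`**).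
* `adelicMatrixFourier_eq_adelicPiFourier` — the matrix transform is the coordinate transform at the
  transpose (`tr(η x) = Σ_{(i,j)} η_{ji} x_{ij}`, `trace_mul_eq_sum_piOfMatrix`);
  **`adelicMatrixFourier_mem_schwartzBruhatAdelicMatrix`** — `𝒮(M_n(𝔸_K))` is stable under `Φ ↦ Φ̂`;
  **`tsum_eq_inv_measure_mul_tsum_adelicMatrixFourier`** — Poisson summation
  `Σ_{ξ ∈ M_n(K)} Φ(ξ) = λ(D_M)⁻¹ Σ_{ξ ∈ M_n(K)} Φ̂(ξ)` (`D_M = matrixFundamentalDomain n K`, the matrices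
  with entries in Tate's domain), with the absolute convergence of both sides
  (`summable_norm_of_mem_schwartzBruhatAdelicMatrix`,
  `summable_norm_adelicMatrixFourier_of_mem_schwartzBruhatAdelicMatrix`).

Library note (review of `AdelicPiSchwartzBruhatFourier`): the tree holds three adelic Schwartz–Bruhat
spaces — `adelicSchwartzBruhat K n` of `MirabolicEisensteinSeries` (Bump's generators on `𝔸_K^n` with
place-by-place archimedean factor; a submodule of `piSchwartzBruhat K (Fin n)`, in general proper),
`schwartzBruhatAdelicMatrix n K` (this file identifies it with `piSchwartzBruhat K (Fin n × Fin n)`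
along `matrixOfPi`/`piOfMatrix`), and `piSchwartzBruhat K ι`. The inclusion
`adelicSchwartzBruhat K n ≤ piSchwartzBruhat K (Fin n)` needs the tensor product of Schwartz maps on
`∏_w K_w^n` and is not used here.

## References

* R. Godement, H. Jacquet, *Zeta functions of simple algebras*, LNM 260 (1972), §11
  [GodementJacquetLNM260].
* J. Tate, in Cassels–Fröhlich (eds.), *Algebraic Number Theory* (1967), Ch. XV, Lemma 4.2.4
  [CasselsFrohlichANT1967].
* A. Weil, *Basic Number Theory* (1967), Ch. IV §3, Ch. VII §2 [WeilBNT1967].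
-/

noncomputable section

open scoped MatrixGroups NNReal ENNReal SchwartzMap Classical Pointwise Matrix
open NumberField NumberField.mixedEmbedding IsDedekindDomain MeasureTheory MeasureTheory.Measure Set Filter

namespace Literature.NumberTheory.Automorphic

/-! ### Archimedean and finite parts of two-sided products; twists -/

section Parts

variable (n : ℕ) (K : Type) [Field K] [NumberField K]

/-- The archimedean coordinate ring homomorphism `𝔸_K → K_∞ ≅ K ⊗ ℝ` (first projection followed by
Mathlib's `InfiniteAdeleRing.ringEquiv_mixedSpace`). [folklore] -/
def archHom : AdeleRing (𝓞 K) K →+* mixedSpace K :=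
  (InfiniteAdeleRing.ringEquiv_mixedSpace K).toRingHom.comp
    (RingHom.fst (InfiniteAdeleRing K) (FiniteAdeleRing (𝓞 K) K))

variable {n K}

/-- `archHom K x = ringEquiv_mixedSpace K x_∞` (definitional). [folklore] -/
theorem archHom_apply (x : AdeleRing (𝓞 K) K) :
    archHom K x = InfiniteAdeleRing.ringEquiv_mixedSpace K x.1 := rfl

/-- `adelicMatrixArch` is the entrywise image under `archHom` (definitional). [folklore] -/
theorem adelicMatrixArch_eq_map (x : Matrix (Fin n) (Fin n) (AdeleRing (𝓞 K) K)) :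
    adelicMatrixArch n K x = Matrix.of.symm (x.map (archHom K)) := rfl

/-- **Archimedean part of a two-sided product**: `(A x B)_∞ = A_∞ x_∞ B_∞`. [folklore] -/
theorem adelicMatrixArch_mul_mul (A x B : Matrix (Fin n) (Fin n) (AdeleRing (𝓞 K) K)) :
    adelicMatrixArch n K (A * x * B) =
      Matrix.of.symm (A.map (archHom K) * Matrix.of (adelicMatrixArch n K x) * B.map (archHom K)) := by
  rw [adelicMatrixArch_eq_map, adelicMatrixArch_eq_map, Matrix.map_mul, Matrix.map_mul]
  rfl

/-- **`adelicMatrixFinite` is multiplicative**: `(x y)_f = x_f y_f`. [folklore] -/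
theorem adelicMatrixFinite_mul (x y : Matrix (Fin n) (Fin n) (AdeleRing (𝓞 K) K)) :
    adelicMatrixFinite n K (x * y) = adelicMatrixFinite n K x * adelicMatrixFinite n K y := by
  refine Matrix.ext fun i j => ?_
  simp only [adelicMatrixFinite, Matrix.map_apply, Matrix.mul_apply]
  exact AdeleRing.snd_sum K Finset.univ (fun k => x i k * y k j)

/-- **Finite part of a two-sided product**: `(A x B)_f = A_f x_f B_f`. [folklore] -/
theorem adelicMatrixFinite_mul_mul (A x B : Matrix (Fin n) (Fin n) (AdeleRing (𝓞 K) K)) :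
    adelicMatrixFinite n K (A * x * B) =
      adelicMatrixFinite n K A * adelicMatrixFinite n K x * adelicMatrixFinite n K B := by
  rw [adelicMatrixFinite_mul, adelicMatrixFinite_mul]

variable (n K)

/-- **Two-sided multiplication by archimedean units as a continuous linear automorphism** of the
real vector space `M_n(K ⊗ ℝ)`: `X ↦ U X V`. [folklore] -/
def archTwistCLE (U V : (Matrix (Fin n) (Fin n) (mixedSpace K))ˣ) :
    (Fin n → Fin n → mixedSpace K) ≃L[ℝ] (Fin n → Fin n → mixedSpace K) :=
  LinearEquiv.toContinuousLinearEquiv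
    { toFun := fun X => Matrix.of.symm ((U : Matrix (Fin n) (Fin n) (mixedSpace K)) * Matrix.of X *
        (V : Matrix (Fin n) (Fin n) (mixedSpace K)))
      invFun := fun X => Matrix.of.symm (((U⁻¹ : (Matrix (Fin n) (Fin n) (mixedSpace K))ˣ) :
          Matrix (Fin n) (Fin n) (mixedSpace K)) * Matrix.of X *
        ((V⁻¹ : (Matrix (Fin n) (Fin n) (mixedSpace K))ˣ) : Matrix (Fin n) (Fin n) (mixedSpace K)))
      map_add' := fun X Y => by
        change (U : Matrix (Fin n) (Fin n) (mixedSpace K)) * (Matrix.of X + Matrix.of Y) * _ = _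
        rw [Matrix.mul_add, Matrix.add_mul]
        rfl
      map_smul' := fun c X => by
        change (U : Matrix (Fin n) (Fin n) (mixedSpace K)) * (c • Matrix.of X) * _ = _
        rw [Matrix.mul_smul, Matrix.smul_mul]
        rfl
      left_inv := fun X => by
        change Matrix.of.symm (((U⁻¹ : (Matrix (Fin n) (Fin n) (mixedSpace K))ˣ) :
          Matrix (Fin n) (Fin n) (mixedSpace K)) *
            ((U : Matrix (Fin n) (Fin n) (mixedSpace K)) * Matrix.of X *
              (V : Matrix (Fin n) (Fin n) (mixedSpace K))) *
          ((V⁻¹ : (Matrix (Fin n) (Fin n) (mixedSpace K))ˣ) : Matrix (Fin n) (Fin n) (mixedSpace K))) = X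
        rw [← Matrix.mul_assoc, ← Matrix.mul_assoc, Units.inv_mul, Matrix.one_mul, Matrix.mul_assoc,
          Units.mul_inv, Matrix.mul_one]
        rfl
      right_inv := fun X => by
        change Matrix.of.symm ((U : Matrix (Fin n) (Fin n) (mixedSpace K)) *
            (((U⁻¹ : (Matrix (Fin n) (Fin n) (mixedSpace K))ˣ) : Matrix (Fin n) (Fin n) (mixedSpace K)) *
              Matrix.of X *
              ((V⁻¹ : (Matrix (Fin n) (Fin n) (mixedSpace K))ˣ) : Matrix (Fin n) (Fin n) (mixedSpace K))) *
          (V : Matrix (Fin n) (Fin n) (mixedSpace K))) = X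
        rw [← Matrix.mul_assoc, ← Matrix.mul_assoc, Units.mul_inv, Matrix.one_mul, Matrix.mul_assoc,
          Units.inv_mul, Matrix.mul_one]
        rfl }

variable {n K}

/-- Unfolding of `archTwistCLE`. [folklore] -/
theorem archTwistCLE_apply (U V : (Matrix (Fin n) (Fin n) (mixedSpace K))ˣ)
    (X : Fin n → Fin n → mixedSpace K) :
    archTwistCLE n K U V X = Matrix.of.symm ((U : Matrix (Fin n) (Fin n) (mixedSpace K)) *
      Matrix.of X * (V : Matrix (Fin n) (Fin n) (mixedSpace K))) := rfl

variable (n K)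

/-- The archimedean image `GL_n(𝔸_K) → GL_n(K ⊗ ℝ)` of a unit (entrywise `archHom`). [folklore] -/
def GLn.archUnit : GL (Fin n) (AdeleRing (𝓞 K) K) →* (Matrix (Fin n) (Fin n) (mixedSpace K))ˣ :=
  Matrix.GeneralLinearGroup.map (archHom K)

/-- The finite image `GL_n(𝔸_K) → GL_n(𝔸_K^∞)` of a unit (entrywise second projection). [folklore] -/
def GLn.finUnit : GL (Fin n) (AdeleRing (𝓞 K) K) →* GL (Fin n) (FiniteAdeleRing (𝓞 K) K) :=
  Matrix.GeneralLinearGroup.map (RingHom.snd (InfiniteAdeleRing K) (FiniteAdeleRing (𝓞 K) K))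

variable {n K}

/-- Entries of `GLn.archUnit`. [folklore] -/
theorem GLn.coe_archUnit (A : GL (Fin n) (AdeleRing (𝓞 K) K)) :
    ((GLn.archUnit n K A : (Matrix (Fin n) (Fin n) (mixedSpace K))ˣ) : Matrix (Fin n) (Fin n) (mixedSpace K)) =
      (A : Matrix (Fin n) (Fin n) (AdeleRing (𝓞 K) K)).map (archHom K) := rfl

/-- Entries of `GLn.finUnit`. [folklore] -/
theorem GLn.coe_finUnit (A : GL (Fin n) (AdeleRing (𝓞 K) K)) :
    ((GLn.finUnit n K A : GL (Fin n) (FiniteAdeleRing (𝓞 K) K)) : Matrix (Fin n) (Fin n) (FiniteAdeleRing (𝓞 K) K)) =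
      adelicMatrixFinite n K (A : Matrix (Fin n) (Fin n) (AdeleRing (𝓞 K) K)) := rfl

/-- **Two-sided multiplication by finite-adelic units is a homeomorphism of `M_n(𝔸_K^∞)`**.
[folklore] -/
def finTwistHomeomorph (U V : GL (Fin n) (FiniteAdeleRing (𝓞 K) K)) :
    Matrix (Fin n) (Fin n) (FiniteAdeleRing (𝓞 K) K) ≃ₜ Matrix (Fin n) (Fin n) (FiniteAdeleRing (𝓞 K) K) where
  toFun y := (U : Matrix (Fin n) (Fin n) (FiniteAdeleRing (𝓞 K) K)) * y * (V : Matrix (Fin n) (Fin n) (FiniteAdeleRing (𝓞 K) K))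
  invFun y := ((U⁻¹ : GL (Fin n) (FiniteAdeleRing (𝓞 K) K)) : Matrix (Fin n) (Fin n) (FiniteAdeleRing (𝓞 K) K)) * y *
    ((V⁻¹ : GL (Fin n) (FiniteAdeleRing (𝓞 K) K)) : Matrix (Fin n) (Fin n) (FiniteAdeleRing (𝓞 K) K))
  left_inv y := by
    simp only
    rw [← Matrix.mul_assoc, ← Matrix.mul_assoc, Units.inv_mul, Matrix.one_mul, Matrix.mul_assoc,
      Units.mul_inv, Matrix.mul_one]
  right_inv y := by
    simp only
    rw [← Matrix.mul_assoc, ← Matrix.mul_assoc, Units.mul_inv, Matrix.one_mul, Matrix.mul_assoc,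
      Units.inv_mul, Matrix.mul_one]
  continuous_toFun := (continuous_const.mul continuous_id).mul continuous_const
  continuous_invFun := (continuous_const.mul continuous_id).mul continuous_const

/-- **The Schwartz–Bruhat generators are stable under two-sided twists**: if `Φ = Φ_∞ ⊗ Φ_f` is a
factorizable Schwartz–Bruhat function on `M_n(𝔸_K)` then so is `x ↦ Φ(A x B)` for
`A, B ∈ GL_n(𝔸_K)` (`Φ_∞ ∘ (X ↦ A_∞ X B_∞)` is Schwartz, `Φ_f ∘ (y ↦ A_f y B_f)` is locally constant
of compact support). (Godement–Jacquet, LNM 260, §11: the operators `Φ ↦ Φ(a · b)` on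
`𝒮(M_n(𝔸))`.) [folklore] -/
theorem IsFactorizableSchwartzBruhat.comp_mul_mul {Φ : Matrix (Fin n) (Fin n) (AdeleRing (𝓞 K) K) → ℂ}
    (h : IsFactorizableSchwartzBruhat n K Φ) (A B : GL (Fin n) (AdeleRing (𝓞 K) K)) :
    IsFactorizableSchwartzBruhat n K fun x =>
      Φ ((A : Matrix (Fin n) (Fin n) (AdeleRing (𝓞 K) K)) * x * (B : Matrix (Fin n) (Fin n) (AdeleRing (𝓞 K) K))) := by
  obtain ⟨Φinf, Φfin, hfin, rfl⟩ := h
  refine ⟨SchwartzMap.compCLMOfContinuousLinearEquiv ℂ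
      (archTwistCLE n K (GLn.archUnit n K A) (GLn.archUnit n K B)) Φinf,
    fun y => Φfin (finTwistHomeomorph (GLn.finUnit n K A) (GLn.finUnit n K B) y), ?_, ?_⟩
  · obtain ⟨hlc, hcs⟩ := (mem_schwartzBruhat_iff).1 hfin
    exact (mem_schwartzBruhat_iff).2
      ⟨hlc.comp_continuous (finTwistHomeomorph _ _).continuous, hcs.comp_homeomorph _⟩
  · funext x
    simp only [SchwartzMap.compCLMOfContinuousLinearEquiv_apply, Function.comp_apply,
      archTwistCLE_apply, GLn.coe_archUnit, adelicMatrixArch_mul_mul, adelicMatrixFinite_mul_mul]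
    rfl

/-- **`𝒮(M_n(𝔸_K))` is stable under two-sided twists** `Φ ↦ Φ(A · B)`, `A, B ∈ GL_n(𝔸_K)`
(Godement–Jacquet, LNM 260, §11). [folklore] -/
theorem comp_mul_mul_mem_schwartzBruhatAdelicMatrix {Φ : Matrix (Fin n) (Fin n) (AdeleRing (𝓞 K) K) → ℂ}
    (hΦ : Φ ∈ schwartzBruhatAdelicMatrix n K) (A B : GL (Fin n) (AdeleRing (𝓞 K) K)) :
    (fun x => Φ ((A : Matrix (Fin n) (Fin n) (AdeleRing (𝓞 K) K)) * x *
      (B : Matrix (Fin n) (Fin n) (AdeleRing (𝓞 K) K)))) ∈ schwartzBruhatAdelicMatrix n K := by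
  induction hΦ using Submodule.span_induction with
  | mem Φ h => exact mem_schwartzBruhatAdelicMatrix (h.comp_mul_mul A B)
  | zero => exact zero_mem _
  | add Φ Ψ _ _ ihΦ ihΨ => exact add_mem ihΦ ihΨ
  | smul c Φ _ ih => exact Submodule.smul_mem _ c ih

/-- **The two-sided twist homeomorphism `x ↦ A x B` of `M_n(𝔸_K)`**. [folklore] -/
def twistHomeomorph (A B : GL (Fin n) (AdeleRing (𝓞 K) K)) :
    Matrix (Fin n) (Fin n) (AdeleRing (𝓞 K) K) ≃ₜ Matrix (Fin n) (Fin n) (AdeleRing (𝓞 K) K) where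
  toFun x := (A : Matrix (Fin n) (Fin n) (AdeleRing (𝓞 K) K)) * x * (B : Matrix (Fin n) (Fin n) (AdeleRing (𝓞 K) K))
  invFun y := ((A⁻¹ : GL (Fin n) (AdeleRing (𝓞 K) K)) : Matrix (Fin n) (Fin n) (AdeleRing (𝓞 K) K)) * y *
    ((B⁻¹ : GL (Fin n) (AdeleRing (𝓞 K) K)) : Matrix (Fin n) (Fin n) (AdeleRing (𝓞 K) K))
  left_inv x := by
    simp only
    rw [← Matrix.mul_assoc, ← Matrix.mul_assoc, Units.inv_mul, Matrix.one_mul, Matrix.mul_assoc,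
      Units.mul_inv, Matrix.mul_one]
  right_inv y := by
    simp only
    rw [← Matrix.mul_assoc, ← Matrix.mul_assoc, Units.mul_inv, Matrix.one_mul, Matrix.mul_assoc,
      Units.inv_mul, Matrix.mul_one]
  continuous_toFun := (continuous_const.mul continuous_id).mul continuous_const
  continuous_invFun := (continuous_const.mul continuous_id).mul continuous_const

/-- The preimage of a set under `x ↦ A x B` is the two-sided translate `A⁻¹ S B⁻¹`. [folklore] -/
theorem preimage_twistHomeomorph (A B : GL (Fin n) (AdeleRing (𝓞 K) K))
    (S : Set (Matrix (Fin n) (Fin n) (AdeleRing (𝓞 K) K))) :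
    twistHomeomorph A B ⁻¹' S =
      (A⁻¹ : GL (Fin n) (AdeleRing (𝓞 K) K)) • (Units.opEquiv.symm (MulOpposite.op B⁻¹) • S) := by
  ext x
  simp only [Set.mem_preimage, Set.mem_smul_set]
  constructor
  · intro hx
    refine ⟨(A : Matrix (Fin n) (Fin n) (AdeleRing (𝓞 K) K)) * x, ⟨_, hx, ?_⟩, ?_⟩
    · simp only [Units.smul_def, Units.coe_opEquiv_symm, MulOpposite.unop_op,
        MulOpposite.smul_eq_mul_unop]
      change (A : Matrix (Fin n) (Fin n) (AdeleRing (𝓞 K) K)) * x *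
        (B : Matrix (Fin n) (Fin n) (AdeleRing (𝓞 K) K)) *
        ((B⁻¹ : GL (Fin n) (AdeleRing (𝓞 K) K)) : Matrix (Fin n) (Fin n) (AdeleRing (𝓞 K) K)) = _
      rw [Matrix.mul_assoc, Units.mul_inv, Matrix.mul_one]
    · simp only [Units.smul_def, smul_eq_mul]
      rw [← Matrix.mul_assoc, Units.inv_mul, Matrix.one_mul]
  · rintro ⟨y, ⟨s, hs, rfl⟩, rfl⟩
    simp only [Units.smul_def, Units.coe_opEquiv_symm, MulOpposite.unop_op,
      MulOpposite.smul_eq_mul_unop, smul_eq_mul]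
    change (A : Matrix (Fin n) (Fin n) (AdeleRing (𝓞 K) K)) *
      (((A⁻¹ : GL (Fin n) (AdeleRing (𝓞 K) K)) : Matrix (Fin n) (Fin n) (AdeleRing (𝓞 K) K)) *
        (s * ((B⁻¹ : GL (Fin n) (AdeleRing (𝓞 K) K)) : Matrix (Fin n) (Fin n) (AdeleRing (𝓞 K) K)))) *
      (B : Matrix (Fin n) (Fin n) (AdeleRing (𝓞 K) K)) ∈ S
    rw [← Matrix.mul_assoc, Units.mul_inv, Matrix.one_mul, Matrix.mul_assoc, Units.inv_mul,
      Matrix.mul_one]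
    exact hs

end Parts

/-! ### The Fourier transform on `M_n(𝔸_K)` and the substitution `x ↦ A x B` -/

section Fourier

variable (n : ℕ) (K : Type) [Field K] [NumberField K]
  [MeasurableSpace (Matrix (Fin n) (Fin n) (AdeleRing (𝓞 K) K))]

/-- The **adelic Fourier transform on `M_n(𝔸_K)`** for the trace pairing and Tate's character
`ψ = adeleAddChar K`: `Φ̂(η) = ∫ Φ(x) ψ(tr(η x)) dλ(x)` (`λ` an additive Haar measure on
`M_n(𝔸_K)`; Godement–Jacquet, LNM 260, §11: "`Φ̂(x) = ∫ Φ(y) ψ(tr(xy)) dy`"; Tate's `f̂` for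
`n = 1`). [cite: GodementJacquetLNM260, §11] -/
def adelicMatrixFourier (lam : Measure (Matrix (Fin n) (Fin n) (AdeleRing (𝓞 K) K)))
    (Φ : Matrix (Fin n) (Fin n) (AdeleRing (𝓞 K) K) → ℂ) (η : Matrix (Fin n) (Fin n) (AdeleRing (𝓞 K) K)) : ℂ :=
  ∫ x, Φ x * (adeleAddChar K (Matrix.trace (η * x)) : ℂ) ∂lam

variable {n K}

/-- Unfolding of `adelicMatrixFourier`. [folklore] -/
theorem adelicMatrixFourier_apply (lam : Measure (Matrix (Fin n) (Fin n) (AdeleRing (𝓞 K) K)))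
    (Φ : Matrix (Fin n) (Fin n) (AdeleRing (𝓞 K) K) → ℂ) (η : Matrix (Fin n) (Fin n) (AdeleRing (𝓞 K) K)) :
    adelicMatrixFourier n K lam Φ η = ∫ x, Φ x * (adeleAddChar K (Matrix.trace (η * x)) : ℂ) ∂lam := rfl

variable [BorelSpace (Matrix (Fin n) (Fin n) (AdeleRing (𝓞 K) K))]
  (lam : Measure (Matrix (Fin n) (Fin n) (AdeleRing (𝓞 K) K))) [lam.IsAddHaarMeasure] [lam.Regular]

/-- **The image of a Haar measure under `x ↦ A x B` is `|det A|_𝔸⁻ⁿ |det B|_𝔸⁻ⁿ` times the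
measure** (modules of left and right multiplication, `MatrixAdeleModule`). [folklore] -/
theorem map_twistHomeomorph_eq_smul (A B : GL (Fin n) (AdeleRing (𝓞 K) K)) :
    lam.map (twistHomeomorph A B) =
      (((adelicAbsDet n K A⁻¹ ^ n * adelicAbsDet n K B⁻¹ ^ n : ℝ≥0)) : ℝ≥0∞) • lam := by
  haveI := locallyCompactSpace_adeleRing' K
  haveI : LocallyCompactSpace (Matrix (Fin n) (Fin n) (AdeleRing (𝓞 K) K)) :=
    inferInstanceAs (LocallyCompactSpace (Fin n → Fin n → AdeleRing (𝓞 K) K))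
  refine Measure.ext fun S hS => ?_
  rw [Measure.map_apply (twistHomeomorph A B).continuous.measurable hS, preimage_twistHomeomorph,
    addHaar_matrix_smul_eq n K lam, addHaar_matrix_op_smul_eq n K lam, Measure.smul_apply,
    smul_eq_mul, ← mul_assoc, ENNReal.coe_mul, ENNReal.coe_pow, ENNReal.coe_pow]

/-- **Substitution formula for the twisted transform** (Godement–Jacquet, LNM 260, §11, the identity
behind the functional equation of the theta series): for `A, B ∈ GL_n(𝔸_K)`,
`(Φ(A · B))^(η) = |det A|_𝔸⁻ⁿ |det B|_𝔸⁻ⁿ Φ̂(B⁻¹ η A⁻¹)`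
(substitute `y = A x B`, `dλ(x) = |det A|⁻ⁿ|det B|⁻ⁿ dλ(y)`, `tr(η A⁻¹ y B⁻¹) = tr(B⁻¹ η A⁻¹ y)`).
[cite: GodementJacquetLNM260, §11] -/
theorem adelicMatrixFourier_comp_mul_mul (Φ : Matrix (Fin n) (Fin n) (AdeleRing (𝓞 K) K) → ℂ)
    (A B : GL (Fin n) (AdeleRing (𝓞 K) K)) (η : Matrix (Fin n) (Fin n) (AdeleRing (𝓞 K) K)) :
    adelicMatrixFourier n K lam (fun x => Φ ((A : Matrix (Fin n) (Fin n) (AdeleRing (𝓞 K) K)) * x *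
        (B : Matrix (Fin n) (Fin n) (AdeleRing (𝓞 K) K)))) η =
      ((adelicAbsDet n K A⁻¹ ^ n * adelicAbsDet n K B⁻¹ ^ n : ℝ≥0) : ℂ) *
        adelicMatrixFourier n K lam Φ
          (((B⁻¹ : GL (Fin n) (AdeleRing (𝓞 K) K)) : Matrix (Fin n) (Fin n) (AdeleRing (𝓞 K) K)) * η *
            ((A⁻¹ : GL (Fin n) (AdeleRing (𝓞 K) K)) : Matrix (Fin n) (Fin n) (AdeleRing (𝓞 K) K))) := by
  set T := twistHomeomorph (K := K) A B with hT
  set η' : Matrix (Fin n) (Fin n) (AdeleRing (𝓞 K) K) :=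
    ((B⁻¹ : GL (Fin n) (AdeleRing (𝓞 K) K)) : Matrix (Fin n) (Fin n) (AdeleRing (𝓞 K) K)) * η *
      ((A⁻¹ : GL (Fin n) (AdeleRing (𝓞 K) K)) : Matrix (Fin n) (Fin n) (AdeleRing (𝓞 K) K)) with hη'
  set G : Matrix (Fin n) (Fin n) (AdeleRing (𝓞 K) K) → ℂ := fun y =>
    Φ y * (adeleAddChar K (Matrix.trace (η' * y)) : ℂ) with hG
  -- the integrand is `G ∘ T`
  have hcomp : (fun x => Φ ((A : Matrix (Fin n) (Fin n) (AdeleRing (𝓞 K) K)) * x *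
      (B : Matrix (Fin n) (Fin n) (AdeleRing (𝓞 K) K))) *
        (adeleAddChar K (Matrix.trace (η * x)) : ℂ)) = fun x => G (T x) := by
    funext x
    simp only [hG, hT]
    congr 3
    change Matrix.trace (η * x) = Matrix.trace (η' * ((A : Matrix (Fin n) (Fin n) (AdeleRing (𝓞 K) K)) * x *
      (B : Matrix (Fin n) (Fin n) (AdeleRing (𝓞 K) K))))
    rw [hη', show ((B⁻¹ : GL (Fin n) (AdeleRing (𝓞 K) K)) : Matrix (Fin n) (Fin n) (AdeleRing (𝓞 K) K)) * η *
        ((A⁻¹ : GL (Fin n) (AdeleRing (𝓞 K) K)) : Matrix (Fin n) (Fin n) (AdeleRing (𝓞 K) K)) *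
        ((A : Matrix (Fin n) (Fin n) (AdeleRing (𝓞 K) K)) * x * (B : Matrix (Fin n) (Fin n) (AdeleRing (𝓞 K) K))) =
      ((B⁻¹ : GL (Fin n) (AdeleRing (𝓞 K) K)) : Matrix (Fin n) (Fin n) (AdeleRing (𝓞 K) K)) * (η * x) *
        (B : Matrix (Fin n) (Fin n) (AdeleRing (𝓞 K) K)) by
      simp only [Matrix.mul_assoc]
      rw [← Matrix.mul_assoc ((A⁻¹ : GL (Fin n) (AdeleRing (𝓞 K) K)) : Matrix (Fin n) (Fin n) (AdeleRing (𝓞 K) K)),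
        Units.inv_mul, Matrix.one_mul],
      Matrix.trace_mul_cycle, Units.mul_inv, Matrix.one_mul]
  rw [adelicMatrixFourier_apply, adelicMatrixFourier_apply, hcomp,
    show (fun x => G (T x)) = fun x => G (T.toMeasurableEquiv x) from by
      funext x; rw [Homeomorph.toMeasurableEquiv_coe],
    ← integral_map_equiv, Homeomorph.toMeasurableEquiv_coe, hT, map_twistHomeomorph_eq_smul lam A B,
    integral_smul_measure, ENNReal.coe_toReal, hG]
  simp only [NNReal.coe_mul, NNReal.coe_pow, Complex.real_smul, Complex.ofReal_mul, Complex.ofReal_pow]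

end Fourier


/-! ### Reindexing the coordinates of `𝔸_K^ι` -/

section Reindex

variable (K : Type) [Field K] [NumberField K] {ι ι' : Type} [Fintype ι] [Fintype ι']

/-- Precomposition with a bijection of index types, as a homeomorphism of function spaces.
[folklore] -/
def piCompHomeomorph (X : Type*) [TopologicalSpace X] (e : ι ≃ ι') : (ι' → X) ≃ₜ (ι → X) where
  toFun b := b ∘ e
  invFun a := a ∘ e.symm
  left_inv b := funext fun i => by simp
  right_inv a := funext fun i => by simp
  continuous_toFun := continuous_pi fun i => continuous_apply _
  continuous_invFun := continuous_pi fun i => continuous_apply _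

variable {K}

/-- **The factorizable Schwartz–Bruhat functions are stable under reindexing of the coordinates.**
[folklore] -/
theorem IsFactorizablePiSchwartzBruhat.comp_equiv {Φ : (ι → AdeleRing (𝓞 K) K) → ℂ}
    (h : IsFactorizablePiSchwartzBruhat K ι Φ) (e : ι ≃ ι') :
    IsFactorizablePiSchwartzBruhat K ι' fun w => Φ (w ∘ e) := by
  obtain ⟨Φinf, Φfin, hfin, rfl⟩ := h
  refine ⟨SchwartzMap.compCLMOfContinuousLinearEquiv ℂ
      ((LinearEquiv.funCongrLeft ℝ (mixedSpace K) e).toContinuousLinearEquiv) Φinf,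
    fun b => Φfin (b ∘ e), ?_, ?_⟩
  · obtain ⟨hlc, hcs⟩ := (mem_schwartzBruhat_iff).1 hfin
    exact (mem_schwartzBruhat_iff).2
      ⟨hlc.comp_continuous (piCompHomeomorph (FiniteAdeleRing (𝓞 K) K) e).continuous,
        hcs.comp_homeomorph (piCompHomeomorph (FiniteAdeleRing (𝓞 K) K) e)⟩
  · funext w
    rfl

/-- **`𝒮(𝔸_K^ι)` is stable under reindexing of the coordinates.** [folklore] -/
theorem comp_equiv_mem_piSchwartzBruhat {Φ : (ι → AdeleRing (𝓞 K) K) → ℂ}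
    (hΦ : Φ ∈ piSchwartzBruhat K ι) (e : ι ≃ ι') :
    (fun w : ι' → AdeleRing (𝓞 K) K => Φ (w ∘ e)) ∈ piSchwartzBruhat K ι' := by
  induction hΦ using Submodule.span_induction with
  | mem Φ h => exact mem_piSchwartzBruhat (h.comp_equiv e)
  | zero => exact zero_mem _
  | add Φ Ψ _ _ ihΦ ihΨ => exact add_mem ihΦ ihΨ
  | smul c Φ _ ih => exact Submodule.smul_mem _ c ih

end Reindex

/-! ### Matrices as functions on pairs of indices -/

section MatrixPi

variable (n : ℕ) (K : Type) [Field K] [NumberField K]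

/-- A matrix as a function on pairs of indices. [folklore] -/
def piOfMatrix {R : Type*} (x : Matrix (Fin n) (Fin n) R) : Fin n × Fin n → R := fun p => x p.1 p.2

/-- A function on pairs of indices as a matrix. [folklore] -/
def matrixOfPi {R : Type*} (v : Fin n × Fin n → R) : Matrix (Fin n) (Fin n) R :=
  Matrix.of fun i j => v (i, j)

variable {n}

/-- Unfolding of `piOfMatrix`. [folklore] -/
@[simp]
theorem piOfMatrix_apply {R : Type*} (x : Matrix (Fin n) (Fin n) R) (p : Fin n × Fin n) :
    piOfMatrix n x p = x p.1 p.2 := rfl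

/-- Unfolding of `matrixOfPi`. [folklore] -/
@[simp]
theorem matrixOfPi_apply {R : Type*} (v : Fin n × Fin n → R) (i j : Fin n) :
    matrixOfPi n v i j = v (i, j) := rfl

/-- `matrixOfPi ∘ piOfMatrix = id`. [folklore] -/
@[simp]
theorem matrixOfPi_piOfMatrix {R : Type*} (x : Matrix (Fin n) (Fin n) R) :
    matrixOfPi n (piOfMatrix n x) = x := rfl

/-- `piOfMatrix ∘ matrixOfPi = id`. [folklore] -/
@[simp]
theorem piOfMatrix_matrixOfPi {R : Type*} (v : Fin n × Fin n → R) :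
    piOfMatrix n (matrixOfPi n v) = v := rfl

/-- Rational matrices: `matrixOfPi` commutes with the diagonal embedding. [folklore] -/
theorem matrixOfPi_algebraMap (ξ : Fin n × Fin n → K) :
    matrixOfPi n (fun p => algebraMap K (AdeleRing (𝓞 K) K) (ξ p)) =
      (matrixOfPi n ξ).map (algebraMap K (AdeleRing (𝓞 K) K)) := rfl

variable (n)

/-- **`M_n(𝔸_K) ≅ 𝔸_K^{n × n}`** as topological additive groups. [folklore] -/
def matrixPiAddEquiv : Matrix (Fin n) (Fin n) (AdeleRing (𝓞 K) K) ≃ₜ+ (Fin n × Fin n → AdeleRing (𝓞 K) K) where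
  toFun := piOfMatrix n
  invFun := matrixOfPi n
  left_inv := matrixOfPi_piOfMatrix
  right_inv := piOfMatrix_matrixOfPi
  map_add' _ _ := rfl
  continuous_toFun := continuous_pi fun p => continuous_id.matrix_elem p.1 p.2
  continuous_invFun := continuous_pi fun _ => continuous_pi fun _ => continuous_apply _

/-- **`(K ⊗ ℝ)^{n × n} ≅ M_n(K ⊗ ℝ)`** as real topological vector spaces (currying). [folklore] -/
def archCurryCLE : (Fin n × Fin n → mixedSpace K) ≃L[ℝ] (Fin n → Fin n → mixedSpace K) :=
  (LinearEquiv.curry ℝ (mixedSpace K) (Fin n) (Fin n)).toContinuousLinearEquiv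

/-- **`(𝔸_K^∞)^{n × n} ≅ M_n(𝔸_K^∞)`** as topological spaces (currying). [folklore] -/
def finCurryHomeomorph :
    (Fin n × Fin n → FiniteAdeleRing (𝓞 K) K) ≃ₜ Matrix (Fin n) (Fin n) (FiniteAdeleRing (𝓞 K) K) where
  toFun := matrixOfPi n
  invFun := piOfMatrix n
  left_inv := piOfMatrix_matrixOfPi
  right_inv := matrixOfPi_piOfMatrix
  continuous_toFun := continuous_pi fun _ => continuous_pi fun _ => continuous_apply _
  continuous_invFun := continuous_pi fun p => continuous_id.matrix_elem p.1 p.2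

variable {n K}

/-- Archimedean coordinates through `matrixOfPi`. [folklore] -/
theorem adelicMatrixArch_matrixOfPi (v : Fin n × Fin n → AdeleRing (𝓞 K) K) :
    adelicMatrixArch n K (matrixOfPi n v) = archCurryCLE n K (piArch K (Fin n × Fin n) v) := rfl

/-- Finite coordinates through `matrixOfPi`. [folklore] -/
theorem adelicMatrixFinite_matrixOfPi (v : Fin n × Fin n → AdeleRing (𝓞 K) K) :
    adelicMatrixFinite n K (matrixOfPi n v) = finCurryHomeomorph n K (piFinite K (Fin n × Fin n) v) := rfl

/-- Archimedean coordinates through `piOfMatrix`. [folklore] -/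
theorem piArch_piOfMatrix (x : Matrix (Fin n) (Fin n) (AdeleRing (𝓞 K) K)) :
    piArch K (Fin n × Fin n) (piOfMatrix n x) = (archCurryCLE n K).symm (adelicMatrixArch n K x) := rfl

/-- Finite coordinates through `piOfMatrix`. [folklore] -/
theorem piFinite_piOfMatrix (x : Matrix (Fin n) (Fin n) (AdeleRing (𝓞 K) K)) :
    piFinite K (Fin n × Fin n) (piOfMatrix n x) = (finCurryHomeomorph n K).symm (adelicMatrixFinite n K x) := rfl

/-- **Factorizable on `M_n(𝔸_K)` ⇒ factorizable on `𝔸_K^{n × n}`.** [folklore] -/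
theorem IsFactorizableSchwartzBruhat.isFactorizablePi {Φ : Matrix (Fin n) (Fin n) (AdeleRing (𝓞 K) K) → ℂ}
    (h : IsFactorizableSchwartzBruhat n K Φ) :
    IsFactorizablePiSchwartzBruhat K (Fin n × Fin n) fun v => Φ (matrixOfPi n v) := by
  obtain ⟨Φinf, Φfin, hfin, rfl⟩ := h
  refine ⟨SchwartzMap.compCLMOfContinuousLinearEquiv ℂ (archCurryCLE n K) Φinf,
    fun b => Φfin (finCurryHomeomorph n K b), ?_, ?_⟩
  · obtain ⟨hlc, hcs⟩ := (mem_schwartzBruhat_iff).1 hfin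
    exact (mem_schwartzBruhat_iff).2
      ⟨hlc.comp_continuous (finCurryHomeomorph n K).continuous, hcs.comp_homeomorph _⟩
  · funext v
    rfl

/-- **Factorizable on `𝔸_K^{n × n}` ⇒ factorizable on `M_n(𝔸_K)`.** [folklore] -/
theorem IsFactorizablePiSchwartzBruhat.isFactorizableMatrix {Ψ : (Fin n × Fin n → AdeleRing (𝓞 K) K) → ℂ}
    (h : IsFactorizablePiSchwartzBruhat K (Fin n × Fin n) Ψ) :
    IsFactorizableSchwartzBruhat n K fun x => Ψ (piOfMatrix n x) := by
  obtain ⟨Ψinf, Ψfin, hfin, rfl⟩ := h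
  refine ⟨SchwartzMap.compCLMOfContinuousLinearEquiv ℂ (archCurryCLE n K).symm Ψinf,
    fun y => Ψfin ((finCurryHomeomorph n K).symm y), ?_, ?_⟩
  · obtain ⟨hlc, hcs⟩ := (mem_schwartzBruhat_iff).1 hfin
    exact (mem_schwartzBruhat_iff).2
      ⟨hlc.comp_continuous (finCurryHomeomorph n K).symm.continuous, hcs.comp_homeomorph _⟩
  · funext x
    rfl

/-- **`𝒮(M_n(𝔸_K)) → 𝒮(𝔸_K^{n × n})`** along `matrixOfPi`. [folklore] -/
theorem mem_piSchwartzBruhat_of_mem_schwartzBruhatAdelicMatrix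
    {Φ : Matrix (Fin n) (Fin n) (AdeleRing (𝓞 K) K) → ℂ} (hΦ : Φ ∈ schwartzBruhatAdelicMatrix n K) :
    (fun v => Φ (matrixOfPi n v)) ∈ piSchwartzBruhat K (Fin n × Fin n) := by
  induction hΦ using Submodule.span_induction with
  | mem Φ h => exact mem_piSchwartzBruhat h.isFactorizablePi
  | zero => exact zero_mem _
  | add Φ Ψ _ _ ihΦ ihΨ => exact add_mem ihΦ ihΨ
  | smul c Φ _ ih => exact Submodule.smul_mem _ c ih

/-- **`𝒮(𝔸_K^{n × n}) → 𝒮(M_n(𝔸_K))`** along `piOfMatrix`. [folklore] -/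
theorem mem_schwartzBruhatAdelicMatrix_of_mem_piSchwartzBruhat
    {Ψ : (Fin n × Fin n → AdeleRing (𝓞 K) K) → ℂ} (hΨ : Ψ ∈ piSchwartzBruhat K (Fin n × Fin n)) :
    (fun x => Ψ (piOfMatrix n x)) ∈ schwartzBruhatAdelicMatrix n K := by
  induction hΨ using Submodule.span_induction with
  | mem Ψ h => exact mem_schwartzBruhatAdelicMatrix h.isFactorizableMatrix
  | zero => exact zero_mem _
  | add Φ Ψ _ _ ihΦ ihΨ => exact add_mem ihΦ ihΨ
  | smul c Φ _ ih => exact Submodule.smul_mem _ c ih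

/-- **`Σ_{ξ ∈ M_n(K)} |Φ(ξ)| < ∞`** for `Φ ∈ 𝒮(M_n(𝔸_K))`. [folklore] -/
theorem summable_norm_of_mem_schwartzBruhatAdelicMatrix
    {Φ : Matrix (Fin n) (Fin n) (AdeleRing (𝓞 K) K) → ℂ} (hΦ : Φ ∈ schwartzBruhatAdelicMatrix n K) :
    Summable fun ξ : Matrix (Fin n) (Fin n) K => ‖Φ (ξ.map (algebraMap K (AdeleRing (𝓞 K) K)))‖ := by
  have h := summable_norm_of_mem_piSchwartzBruhat (mem_piSchwartzBruhat_of_mem_schwartzBruhatAdelicMatrix hΦ)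
  set e : (Fin n × Fin n → K) ≃ Matrix (Fin n) (Fin n) K :=
    { toFun := matrixOfPi n, invFun := piOfMatrix n, left_inv := piOfMatrix_matrixOfPi,
      right_inv := matrixOfPi_piOfMatrix } with he
  rw [← e.summable_iff]
  exact h

end MatrixPi

/-! ### The transform on `M_n(𝔸_K)` through `𝔸_K^{n × n}`: stability of `𝒮` and Poisson summation -/

section MatrixPoisson

attribute [local instance] secondCountableTopology_adeleRing locallyCompactSpace_adeleRing'

variable (n : ℕ) (K : Type) [Field K] [NumberField K]
  [MeasurableSpace (AdeleRing (𝓞 K) K)] [BorelSpace (AdeleRing (𝓞 K) K)]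
  [MeasurableSpace (Matrix (Fin n) (Fin n) (AdeleRing (𝓞 K) K))]
  [BorelSpace (Matrix (Fin n) (Fin n) (AdeleRing (𝓞 K) K))]
  (lam : Measure (Matrix (Fin n) (Fin n) (AdeleRing (𝓞 K) K)))

variable {n K} in
omit [MeasurableSpace (AdeleRing (𝓞 K) K)] [BorelSpace (AdeleRing (𝓞 K) K)]
  [MeasurableSpace (Matrix (Fin n) (Fin n) (AdeleRing (𝓞 K) K))]
  [BorelSpace (Matrix (Fin n) (Fin n) (AdeleRing (𝓞 K) K))] in
/-- `tr(η x) = Σ_{(i,j)} η_{ji} x_{ij}`: the trace pairing is the coordinate pairing with the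
transpose. [folklore] -/
theorem trace_mul_eq_sum_piOfMatrix (η x : Matrix (Fin n) (Fin n) (AdeleRing (𝓞 K) K)) :
    Matrix.trace (η * x) = ∑ p : Fin n × Fin n, piOfMatrix n ηᵀ p * piOfMatrix n x p := by
  rw [Matrix.trace, Fintype.sum_prod_type, Finset.sum_comm]
  refine Finset.sum_congr rfl fun j _ => ?_
  rw [Matrix.diag_apply, Matrix.mul_apply]
  rfl

/-- The Tate domain of `M_n(𝔸_K)`: the matrices whose entries lie in Tate's fundamental domain
`D` of `𝔸_K ⧸ K` (`piFundamentalDomain` through `piOfMatrix`). [folklore] -/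
def matrixFundamentalDomain : Set (Matrix (Fin n) (Fin n) (AdeleRing (𝓞 K) K)) :=
  piOfMatrix n ⁻¹' piFundamentalDomain K (Fin n × Fin n)

variable {n K}

/-- **The matrix transform is the coordinate transform at the transpose**:
`Φ̂(η) = (Φ ∘ matrixOfPi)^(piOfMatrix ηᵀ)` for the image measure on `𝔸_K^{n × n}`. [folklore] -/
theorem adelicMatrixFourier_eq_adelicPiFourier (Φ : Matrix (Fin n) (Fin n) (AdeleRing (𝓞 K) K) → ℂ)
    (η : Matrix (Fin n) (Fin n) (AdeleRing (𝓞 K) K)) :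
    adelicMatrixFourier n K lam Φ η =
      adelicPiFourier K (Fin n × Fin n) (lam.map (matrixPiAddEquiv n K)) (fun v => Φ (matrixOfPi n v))
        (piOfMatrix n ηᵀ) := by
  haveI : BorelSpace (Fin n × Fin n → AdeleRing (𝓞 K) K) := Pi.borelSpace
  rw [adelicMatrixFourier_apply, adelicPiFourier_apply,
    show (⇑(matrixPiAddEquiv n K) : _ → Fin n × Fin n → AdeleRing (𝓞 K) K) =
      ⇑(matrixPiAddEquiv n K).toHomeomorph.toMeasurableEquiv by
        rw [Homeomorph.toMeasurableEquiv_coe]; rfl,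
    integral_map_equiv]
  refine integral_congr_ae (Eventually.of_forall fun x => ?_)
  beta_reduce
  rw [trace_mul_eq_sum_piOfMatrix]
  rfl

variable [lam.IsAddHaarMeasure]

/-- **`𝒮(M_n(𝔸_K))` is stable under the Fourier transform** (Godement–Jacquet, LNM 260, §11:
`Φ ↦ Φ̂` preserves `𝒮(M_n(𝔸))`; Weil, BNT VII §2), for every additive Haar measure `λ`.
[cite: GodementJacquetLNM260, §11] -/
theorem adelicMatrixFourier_mem_schwartzBruhatAdelicMatrix
    {Φ : Matrix (Fin n) (Fin n) (AdeleRing (𝓞 K) K) → ℂ} (hΦ : Φ ∈ schwartzBruhatAdelicMatrix n K) :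
    adelicMatrixFourier n K lam Φ ∈ schwartzBruhatAdelicMatrix n K := by
  haveI : BorelSpace (Fin n × Fin n → AdeleRing (𝓞 K) K) := Pi.borelSpace
  set Ψ : (Fin n × Fin n → AdeleRing (𝓞 K) K) → ℂ :=
    adelicPiFourier K (Fin n × Fin n) (lam.map (matrixPiAddEquiv n K)) (fun v => Φ (matrixOfPi n v))
    with hΨ
  have hΨmem : Ψ ∈ piSchwartzBruhat K (Fin n × Fin n) :=
    adelicPiFourier_mem_piSchwartzBruhat (mem_piSchwartzBruhat_of_mem_schwartzBruhatAdelicMatrix hΦ)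
  -- reindex by the swap of the two indices (transpose) and come back to matrices
  have hΨ' := mem_schwartzBruhatAdelicMatrix_of_mem_piSchwartzBruhat
    (comp_equiv_mem_piSchwartzBruhat hΨmem (Equiv.prodComm (Fin n) (Fin n)))
  have heq : adelicMatrixFourier n K lam Φ =
      fun x => (fun w : Fin n × Fin n → AdeleRing (𝓞 K) K => Ψ (w ∘ Equiv.prodComm (Fin n) (Fin n)))
        (piOfMatrix n x) := by
    funext η
    rw [adelicMatrixFourier_eq_adelicPiFourier]
    rfl
  rw [heq]
  exact hΨ'

/-- **Poisson summation for `𝒮(M_n(𝔸_K))`** (Godement–Jacquet, LNM 260, §11, the input of the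
theta-series identity; Tate's Lemma 4.2.4 on `M_n(𝔸) = 𝔸^{n²}`): for `Φ ∈ 𝒮(M_n(𝔸_K))` and every
additive Haar measure `λ` on `M_n(𝔸_K)`,
`Σ_{ξ ∈ M_n(K)} Φ(ξ) = λ(D_M)⁻¹ Σ_{ξ ∈ M_n(K)} Φ̂(ξ)`, `D_M = matrixFundamentalDomain`, both sides
converging absolutely. [cite: GodementJacquetLNM260, §11] -/
theorem tsum_eq_inv_measure_mul_tsum_adelicMatrixFourier
    {Φ : Matrix (Fin n) (Fin n) (AdeleRing (𝓞 K) K) → ℂ} (hΦ : Φ ∈ schwartzBruhatAdelicMatrix n K) :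
    ∑' ξ : Matrix (Fin n) (Fin n) K, Φ (ξ.map (algebraMap K (AdeleRing (𝓞 K) K))) =
      (lam (matrixFundamentalDomain n K)).toReal⁻¹ *
        ∑' ξ : Matrix (Fin n) (Fin n) K,
          adelicMatrixFourier n K lam Φ (ξ.map (algebraMap K (AdeleRing (𝓞 K) K))) := by
  haveI : BorelSpace (Fin n × Fin n → AdeleRing (𝓞 K) K) := Pi.borelSpace
  have hΨ := mem_piSchwartzBruhat_of_mem_schwartzBruhatAdelicMatrix hΦ
  have h := tsum_eq_inv_measure_mul_tsum_adelicPiFourier (ν := lam.map (matrixPiAddEquiv n K)) hΨ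
  -- the measure of the Tate domain
  have hm : Measurable (⇑(matrixPiAddEquiv n K) :
      Matrix (Fin n) (Fin n) (AdeleRing (𝓞 K) K) → Fin n × Fin n → AdeleRing (𝓞 K) K) :=
    (matrixPiAddEquiv n K).continuous.measurable
  have hD : (lam.map (matrixPiAddEquiv n K)) (piFundamentalDomain K (Fin n × Fin n)) =
      lam (matrixFundamentalDomain n K) := by
    rw [Measure.map_apply hm (measurableSet_piFundamentalDomain K (Fin n × Fin n))]
    rfl
  rw [hD] at h
  -- reindex the sums over `M_n(K)`
  set e : (Fin n × Fin n → K) ≃ Matrix (Fin n) (Fin n) K :=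
    { toFun := matrixOfPi n, invFun := piOfMatrix n, left_inv := piOfMatrix_matrixOfPi,
      right_inv := matrixOfPi_piOfMatrix } with he
  set e' : (Fin n × Fin n → K) ≃ Matrix (Fin n) (Fin n) K :=
    e.trans ⟨Matrix.transpose, Matrix.transpose, Matrix.transpose_transpose, Matrix.transpose_transpose⟩
    with he'
  have hL : ∑' ξ : Fin n × Fin n → K, Φ (matrixOfPi n fun p => algebraMap K (AdeleRing (𝓞 K) K) (ξ p)) =
      ∑' ξ : Matrix (Fin n) (Fin n) K, Φ (ξ.map (algebraMap K (AdeleRing (𝓞 K) K))) := by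
    rw [← e.tsum_eq]
    rfl
  have hR : ∑' ξ : Fin n × Fin n → K,
      adelicPiFourier K (Fin n × Fin n) (lam.map (matrixPiAddEquiv n K)) (fun v => Φ (matrixOfPi n v))
        (fun p => algebraMap K (AdeleRing (𝓞 K) K) (ξ p)) =
      ∑' ξ : Matrix (Fin n) (Fin n) K,
        adelicMatrixFourier n K lam Φ (ξ.map (algebraMap K (AdeleRing (𝓞 K) K))) := by
    rw [← e'.tsum_eq]
    refine tsum_congr fun ξ => ?_
    rw [adelicMatrixFourier_eq_adelicPiFourier]
    congr 1
  rw [← hL, ← hR]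
  exact h

/-- **`Σ_{ξ ∈ M_n(K)} |Φ̂(ξ)| < ∞`** for `Φ ∈ 𝒮(M_n(𝔸_K))`. [folklore] -/
theorem summable_norm_adelicMatrixFourier_of_mem_schwartzBruhatAdelicMatrix
    {Φ : Matrix (Fin n) (Fin n) (AdeleRing (𝓞 K) K) → ℂ} (hΦ : Φ ∈ schwartzBruhatAdelicMatrix n K) :
    Summable fun ξ : Matrix (Fin n) (Fin n) K =>
      ‖adelicMatrixFourier n K lam Φ (ξ.map (algebraMap K (AdeleRing (𝓞 K) K)))‖ :=
  summable_norm_of_mem_schwartzBruhatAdelicMatrix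
    (adelicMatrixFourier_mem_schwartzBruhatAdelicMatrix lam hΦ)

end MatrixPoisson

end Literature.NumberTheory.Automorphic
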